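import Mathlib
import HarnessLib

/-!
# F1.DR — the CLOSED FORM of the resistive-interchange index `D_R` of a Lee–Cerfon / PCF Solov'ev flux surface in terms of its
# seven certified surface atoms, and its EXACT MONOTONE STRUCTURE in the free constant (shared real algebra for the per-surface files)
(venture LADDER-GRIDFUSION, rung F1 sub-rung F1.DR; cell `gridfusion`, seat `gridfusion-model-7` (g0), 2026-08-27.  Pure real algebra,
no integrals, no instance: the per-surface Bench files (`…Resistive{Edge,Mid,Q1,Q3}`) prove `resistiveIndex g r = (atoms r).DR g` for
the record of certified atoms of that surface and then use the lemmas below.  The EDGE files `…SolovevPCF{Iter,Nstx}ResistiveEdge*.lean`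
(p516941 / p517390 / p518153 / p518870) carry their own copy of this algebra; this file factors it for the interior surfaces.)

## Content (three columns: everything here is CERTIFIED-capable real algebra; nothing is about an equilibrium, a plasma or a device)
For atoms `c = ⟨A4, A6, A7, A9, P, M2, M0⟩` (on a surface: `A4 = ⟨1/R²⟩`, `A6 = ⟨1/|∇Ψ|²⟩`, `A7 = ⟨1/(R²|∇Ψ|²)⟩`, `A9 = ⟨B_p²⟩`, `P = π·phihat`
with `Φ″ = g·phihat·V′`, and Jardin's (8.134) function `F = M2·g² − M0`):
* `c.DR g = −(M2 − M0/g²)/(4P²) + (c.H g − 1/2)²`, `c.H g = ((g²A7 + A4)/(g²A4 + A9) − A6)/(2P)` — `D_R = D_I + (H − 1/2)²`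
  (Zheng (3.42)) with `D_I = −F·V′²/Λ²`, `Λ = −2πΦ″`;
* sign form `c.DR g = c.num g/(4P²·Dn²·g²)`, `c.num g = X²g² − (M2g² − M0)·Dn²`, `X = g²A7 + A4 − (A6 + P)(g²A4 + A9)`, `Dn = g²A4 + A9`;
  generic one-sided tests `num_neg_of` / `num_pos_of` and the linear enclosure `X_bounds_of` used with rational brackets;
* STRUCTURE: `A4² < A7·A9` ⇒ `H` increasing in `g ≥ 0`; `A7 < (A6+P)A4 ∧ A4 < (A6+P)A9` ⇒ `X < 0` ⇒ `H < 1/2`; with `M0 > 0`: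
  **`c.DR` STRICTLY DECREASING on `(0, ∞)`** (`DR_strictAntiOn_of`), hence one certified negative (positive) value propagates up (down).
[cite: Zheng2015, §3.2 eq. (3.42)] for the index; the rest is [folklore] algebra.
-/

noncomputable section

namespace Summit.Ventures.FusionMHD.Bench.ResistiveClosedForm

/-- The seven surface atoms entering the closed form of `D_R` on a Lee–Cerfon / PCF flux surface: `A4 = ⟨1/R²⟩`, `A6 = ⟨1/|∇Ψ|²⟩`,
`A7 = ⟨1/(R²|∇Ψ|²)⟩`, `A9 = ⟨B_p²⟩`, `P = π·phihat` (`Φ″ = g·phihat·V′`), and the slope/intercept `M2`, `M0` of Jardin's function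
`F = M2·g² − M0` (sos-6's exact quadratic structure). [cite: Zheng2015, §3.2 eq. (3.42)] -/
structure DRAtoms where
  /-- `⟨1/R²⟩` -/
  A4 : ℝ
  /-- `⟨1/|∇Ψ|²⟩` -/
  A6 : ℝ
  /-- `⟨1/(R²|∇Ψ|²)⟩` -/
  A7 : ℝ
  /-- `⟨B_p²⟩ = ⟨|∇Ψ|²/R²⟩` -/
  A9 : ℝ
  /-- `π·phihat` -/
  P : ℝ
  /-- slope `M2` of Jardin's `F = M2·g² − M0` -/
  M2 : ℝ
  /-- intercept `M0` -/
  M0 : ℝ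

namespace DRAtoms

variable (c : DRAtoms)

/-- `Dn(g) = g²A4 + A9 = ⟨B²⟩`. [folklore] -/
def Dn (g : ℝ) : ℝ := g ^ 2 * c.A4 + c.A9

/-- `N(g) = g²A7 + A4 = ⟨B²/|∇Ψ|²⟩`. [folklore] -/
def N (g : ℝ) : ℝ := g ^ 2 * c.A7 + c.A4

/-- GGJ's `H` of the volume-relabelled record: `H(g) = (N/Dn − A6)/(2P)`. [cite: Zheng2015, §2.3 eq. (2.64)] -/
def H (g : ℝ) : ℝ := (c.N g / c.Dn g - c.A6) / (2 * c.P)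

/-- THE CLOSED FORM `D_R(g) = −(M2 − M0/g²)/(4P²) + (H − 1/2)²`. [cite: Zheng2015, §3.2 eq. (3.42)] -/
def DR (g : ℝ) : ℝ := -(c.M2 - c.M0 / g ^ 2) / (4 * c.P ^ 2) + (c.H g - 1 / 2) ^ 2

/-- `X(g) = N − (A6 + P)·Dn` (so `H − 1/2 = X/(2P·Dn)`). [folklore] -/
def X (g : ℝ) : ℝ := c.N g - (c.A6 + c.P) * c.Dn g

/-- `num(g) = X²g² − (M2g² − M0)·Dn²`, the sign-carrying polynomial numerator of `D_R`. [folklore] -/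
def num (g : ℝ) : ℝ := c.X g ^ 2 * g ^ 2 - (c.M2 * g ^ 2 - c.M0) * c.Dn g ^ 2

section basic

variable {c} (hA4 : 0 < c.A4) (hA9 : 0 < c.A9) (hP : 0 < c.P)
include hA4 hA9

/-- `Dn > 0`. [folklore] -/
theorem Dn_pos (g : ℝ) : 0 < c.Dn g := by unfold Dn; positivity

include hP

/-- `H − 1/2 = X/(2P·Dn)`. [folklore] -/
theorem H_sub_half (g : ℝ) : c.H g - 1 / 2 = c.X g / (2 * c.P * c.Dn g) := by
  unfold H X
  have hD := (Dn_pos hA4 hA9 g).ne'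
  field_simp
  ring

/-- `D_R = num/(4P²·Dn²·g²)` (`g ≠ 0`). [folklore] -/
theorem DR_eq_num_div {g : ℝ} (hg : g ≠ 0) : c.DR g = c.num g / (4 * c.P ^ 2 * c.Dn g ^ 2 * g ^ 2) := by
  unfold DR num
  rw [H_sub_half hA4 hA9 hP]
  unfold X
  have hD := (Dn_pos hA4 hA9 g).ne'
  field_simp
  ring

/-- `D_R < 0 ↔ num < 0` (`g ≠ 0`). [folklore] -/
theorem DR_neg_iff {g : ℝ} (hg : g ≠ 0) : c.DR g < 0 ↔ c.num g < 0 := by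
  have hD := Dn_pos hA4 hA9 g
  have hden : 0 < 4 * c.P ^ 2 * c.Dn g ^ 2 * g ^ 2 := by positivity
  rw [DR_eq_num_div hA4 hA9 hP hg, div_lt_iff₀ hden, zero_mul]

/-- `0 < D_R ↔ 0 < num` (`g ≠ 0`). [folklore] -/
theorem DR_pos_iff {g : ℝ} (hg : g ≠ 0) : 0 < c.DR g ↔ 0 < c.num g := by
  have hD := Dn_pos hA4 hA9 g
  have hden : 0 < 4 * c.P ^ 2 * c.Dn g ^ 2 * g ^ 2 := by positivity
  rw [DR_eq_num_div hA4 hA9 hP hg, lt_div_iff₀ hden, zero_mul]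

omit hA4 hA9 hP in
/-- One-sided NEGATIVE test: `|X(g)| ≤ xb`, `Dn(g) ≥ dlo ≥ 0`, `M2g² − M0 ≥ mlo ≥ 0`, `xb²g² < mlo·dlo²` ⇒ `num(g) < 0`. [folklore] -/
theorem num_neg_of {g xb dlo mlo : ℝ} (hX : |c.X g| ≤ xb) (hD : dlo ≤ c.Dn g) (hd0 : 0 ≤ dlo)
    (hM : mlo ≤ c.M2 * g ^ 2 - c.M0) (hm0 : 0 ≤ mlo) (h : xb ^ 2 * g ^ 2 < mlo * dlo ^ 2) : c.num g < 0 := by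
  unfold num
  have h1 : c.X g ^ 2 ≤ xb ^ 2 := by
    rw [← sq_abs (c.X g)]; exact pow_le_pow_left₀ (abs_nonneg _) hX 2
  have h2 : dlo ^ 2 ≤ c.Dn g ^ 2 := pow_le_pow_left₀ hd0 hD 2
  have h3 : mlo * dlo ^ 2 ≤ (c.M2 * g ^ 2 - c.M0) * c.Dn g ^ 2 := mul_le_mul hM h2 (by positivity) (hm0.trans hM)
  have h4 : c.X g ^ 2 * g ^ 2 ≤ xb ^ 2 * g ^ 2 := mul_le_mul_of_nonneg_right h1 (sq_nonneg g)
  linarith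

omit hP in
/-- One-sided POSITIVE test: `X(g) ≤ −xlo ≤ 0`, `Dn(g) ≤ dhi`, `0 ≤ M2g² − M0 ≤ mhi`, `mhi·dhi² < xlo²g²` ⇒ `0 < num(g)`. [folklore] -/
theorem num_pos_of {g xlo dhi mhi : ℝ} (hX : c.X g ≤ -xlo) (hx0 : 0 ≤ xlo) (hD : c.Dn g ≤ dhi)
    (hM : c.M2 * g ^ 2 - c.M0 ≤ mhi) (hM0 : 0 ≤ c.M2 * g ^ 2 - c.M0) (h : mhi * dhi ^ 2 < xlo ^ 2 * g ^ 2) :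
    0 < c.num g := by
  unfold num
  have hD0 : 0 ≤ c.Dn g := (Dn_pos hA4 hA9 g).le
  have h1 : xlo ^ 2 ≤ c.X g ^ 2 := by nlinarith
  have h2 : c.Dn g ^ 2 ≤ dhi ^ 2 := pow_le_pow_left₀ hD0 hD 2
  have h3 : (c.M2 * g ^ 2 - c.M0) * c.Dn g ^ 2 ≤ mhi * dhi ^ 2 := mul_le_mul hM h2 (sq_nonneg _) (hM0.trans hM)
  have h4 : xlo ^ 2 * g ^ 2 ≤ c.X g ^ 2 * g ^ 2 := mul_le_mul_of_nonneg_right h1 (sq_nonneg g)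
  linarith

omit hP in
/-- Below the Mercier threshold (`M2g² − M0 < 0`) the numerator is trivially POSITIVE (`D_R ≥ D_I > 0` there). [folklore] -/
theorem num_pos_of_mercier_neg {g : ℝ} (hM : c.M2 * g ^ 2 - c.M0 < 0) : 0 < c.num g := by
  unfold num
  have hD := Dn_pos hA4 hA9 g
  have h1 : 0 ≤ c.X g ^ 2 * g ^ 2 := by positivity
  have h2 : 0 < -(c.M2 * g ^ 2 - c.M0) * c.Dn g ^ 2 := mul_pos (by linarith) (by positivity)
  linarith

omit hA4 hA9 hP in
/-- Linear enclosure of `X(g)` at fixed `g`: with `S = A6 + P ∈ [slo, shi]` (`slo ≥ 0`), `Dn(g) ∈ [dlo, dhi]` (`dlo ≥ 0`),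
`N(g) ∈ [nlo, nhi]`: `nlo − shi·dhi ≤ X(g) ≤ nhi − slo·dlo`. [folklore] -/
theorem X_bounds_of {g slo shi dlo dhi nlo nhi : ℝ} (hS : slo ≤ c.A6 + c.P ∧ c.A6 + c.P ≤ shi) (hs0 : 0 ≤ slo)
    (hD : dlo ≤ c.Dn g ∧ c.Dn g ≤ dhi) (hd0 : 0 ≤ dlo) (hN : nlo ≤ c.N g ∧ c.N g ≤ nhi) :
    nlo - shi * dhi ≤ c.X g ∧ c.X g ≤ nhi - slo * dlo := by
  unfold X
  have h1 : (c.A6 + c.P) * c.Dn g ≤ shi * dhi := mul_le_mul hS.2 hD.2 (hd0.trans hD.1) (hs0.trans (hS.1.trans hS.2))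
  have h2 : slo * dlo ≤ (c.A6 + c.P) * c.Dn g := mul_le_mul hS.1 hD.1 hd0 (hs0.trans hS.1)
  constructor <;> linarith

end basic

/-! ## Exact monotone structure -/

section monotone

variable {c} (hA4 : 0 < c.A4) (hA9 : 0 < c.A9) (hP : 0 < c.P)
include hA4 hA9 hP

omit hA4 hA9 hP in
/-- `X(g) < 0` for every `g` once `A7 < (A6 + P)·A4` and `A4 < (A6 + P)·A9`. [folklore] -/
theorem X_neg_of (h1 : c.A7 < (c.A6 + c.P) * c.A4) (h2 : c.A4 < (c.A6 + c.P) * c.A9) (g : ℝ) : c.X g < 0 := by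
  unfold X N Dn
  have hg2 : 0 ≤ g ^ 2 := sq_nonneg g
  nlinarith [mul_le_mul_of_nonneg_left h1.le hg2]

/-- `X < 0 ⇒ H < 1/2`. [cite: Zheng2015, §2.3 eq. (2.64)] -/
theorem H_lt_half_of (hX : ∀ g, c.X g < 0) (g : ℝ) : c.H g < 1 / 2 := by
  have h := H_sub_half hA4 hA9 hP g
  have hden : 0 < 2 * c.P * c.Dn g := by have := Dn_pos hA4 hA9 g; positivity
  have : c.X g / (2 * c.P * c.Dn g) < 0 := div_neg_of_neg_of_pos (hX g) hden
  linarith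

/-- `A4² < A7·A9 ⇒ H` increasing in `g ≥ 0` (`N/Dn = (g²A7 + A4)/(g²A4 + A9)` increases). [cite: Zheng2015, §2.3 eq. (2.64)] -/
theorem H_mono_of (hc : c.A4 ^ 2 < c.A7 * c.A9) {g₁ g₂ : ℝ} (h0 : 0 ≤ g₁) (h : g₁ ≤ g₂) : c.H g₁ ≤ c.H g₂ := by
  unfold H
  apply div_le_div_of_nonneg_right _ (by positivity)
  suffices hq : c.N g₁ / c.Dn g₁ ≤ c.N g₂ / c.Dn g₂ by linarith
  rw [div_le_div_iff₀ (Dn_pos hA4 hA9 g₁) (Dn_pos hA4 hA9 g₂)]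
  unfold N Dn
  have hsq : g₁ ^ 2 ≤ g₂ ^ 2 := pow_le_pow_left₀ h0 h 2
  nlinarith [mul_nonneg (sub_nonneg.2 hsq) (sub_nonneg.2 hc.le)]

/-- **`D_R` STRICTLY DECREASING on `(0, ∞)`** from `M0 > 0`, `A4² < A7·A9`, `X < 0`. [cite: Zheng2015, §3.2 eq. (3.42)] -/
theorem DR_strictAntiOn_of (hM0 : 0 < c.M0) (hc : c.A4 ^ 2 < c.A7 * c.A9) (hX : ∀ g, c.X g < 0) :
    StrictAntiOn c.DR (Set.Ioi 0) := by
  intro g₁ h₁ g₂ h₂ hlt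
  simp only [Set.mem_Ioi] at h₁ h₂
  have hH := H_mono_of hA4 hA9 hP hc h₁.le hlt.le
  have hH2 := H_lt_half_of hA4 hA9 hP hX g₂
  have hsq : (c.H g₂ - 1 / 2) ^ 2 ≤ (c.H g₁ - 1 / 2) ^ 2 := by
    nlinarith [mul_nonneg (sub_nonneg.2 hH) (by linarith : (0:ℝ) ≤ 1 - c.H g₁ - c.H g₂)]
  have hg : g₁ ^ 2 < g₂ ^ 2 := by nlinarith
  have hterm : c.M0 / g₂ ^ 2 < c.M0 / g₁ ^ 2 := div_lt_div_of_pos_left hM0 (by positivity) hg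
  have hden : 0 < 4 * c.P ^ 2 := by positivity
  have h3 : -(c.M2 - c.M0 / g₂ ^ 2) / (4 * c.P ^ 2) < -(c.M2 - c.M0 / g₁ ^ 2) / (4 * c.P ^ 2) :=
    div_lt_div_of_pos_right (by linarith) hden
  show c.DR g₂ < c.DR g₁
  unfold DR
  linarith

omit hA4 hA9 hP in
/-- One negative value propagates upward along a strictly decreasing `D_R`. [folklore] -/
theorem DR_neg_of_le (hanti : StrictAntiOn c.DR (Set.Ioi 0)) {g₀ g : ℝ} (h0 : 0 < g₀) (h : g₀ ≤ g) (hneg : c.DR g₀ < 0) :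
    c.DR g < 0 := by
  rcases eq_or_lt_of_le h with rfl | hlt
  · exact hneg
  · exact (hanti (Set.mem_Ioi.2 h0) (Set.mem_Ioi.2 (h0.trans hlt)) hlt).trans hneg

omit hA4 hA9 hP in
/-- One positive value propagates downward. [folklore] -/
theorem DR_pos_of_le (hanti : StrictAntiOn c.DR (Set.Ioi 0)) {g g₀ : ℝ} (h0 : 0 < g) (h : g ≤ g₀) (hpos : 0 < c.DR g₀) :
    0 < c.DR g := by
  rcases eq_or_lt_of_le h with rfl | hlt
  · exact hpos
  · exact hpos.trans (hanti (Set.mem_Ioi.2 h0) (Set.mem_Ioi.2 (h0.trans hlt)) hlt)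

end monotone

end DRAtoms

end Summit.Ventures.FusionMHD.Bench.ResistiveClosedForm

end
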